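import Summits.CriticalPhenomena.PercolationContinuityZ3.Theorems.Transplant.SkelPhiForcedKitDefsC
import Summits.CriticalPhenomena.PercolationContinuityZ3.Theorems.Transplant.KNLevelsRelayForced
import Summits.CriticalPhenomena.PercolationContinuityZ3.Theorems.Transplant.KNLevelsEntrance
import HarnessLib

/-!
# N2 (frames-only node `SamePDropOfSkeletonFrm₁`, OPEN), (S0) kit tier, Skel side — J12 REPAIR, part 2: **THE KIT CLAUSE OF A WINDOW LEVEL WITH THE
# RE-CENTRED FORCED KIT** (`Skelφ.pinSetFC`, `Skelφ.kitClauseFC`; successor of `SkelPhiForcedKitClause` p339101 under new names, no edit of landed text)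

J12 / repair (B) 're-centre at the column end' (see `SkelPhiForcedKitDefsC`): `kitClauseFC` = `kitClauseF` VERBATIM except (i) the shell/geometry are
`pinSetFC`/`forcedGeomC` (zone datum about `ctColEnd x`), (ii) the binder `hcol` is GONE (the column ends at the zone's centre: `hcz`), (iii) in `hnear`
the zone datum is read at `ctColEnd x`.  Consequently NO binder of this clause mentions `cylRadMax`, `cylBallFin`, `Frames` or `CylConn`, and the
remaining rows are jointly satisfiable in the order LEVEL 0 `(kz, Λc, Rs)` → `shellD ≥ Rs+1` → `KCmax` → `A, tanOff, cU, cS, rs, r₀` (stmt-g20's values).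
Step IV″ is p1-g16's `KNLevels.relayClause_of_forced` unchanged; Step III is `shyp_kit ∘ kitOK_forcedC`.
builds on p205010 (kernel theorem, internal audit signed; external expert review pending) — nothing in this file uses p205010; nothing here is a
claim about the open node `SamePDropOfSkeletonFrm₁`.
Lane `prim-bschramm`, seat `prim-bschramm-p1` (gen 17); helper file (`--supports stmt-CriticalPhenomena-4575 --as helper`).
* §1 `pinSetFC`, `face_subset_pinSetFC`, `pinSetFC_subset`;  §2 **`kitClauseFC`**.
[cite: KozmaNitzan2024, §4 Lemma 10, Steps III–IV (pp. 19–21)] [this work]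
-/

noncomputable section

open scoped Classical

namespace Summit.CriticalPhenomena.PercolationContinuityZ3.Theorems.Transplant

namespace Skelφ

open MeasureTheory
open Literature.Probability.Percolation Literature.Probability.LatticeModels SimpleGraph KNLevels
open Literature.Barriers.CriticalPhenomena (graphBall graphBall_finite mem_graphBall_self graphBall_mono)
open Skel (winGraph winGraph_adj winGraph_le KitGeom)
open SkelI (tanOff tanTgt tanTgt_mem kitSeed edgesIn_subset_kitSeed)
open Literature.Probability.Percolation.KozmaNitzan.Cells (oth oth_ne eq_oth_of_ne oth_oth)

variable {V : Type} [DecidableEq V] {G : SimpleGraph V} [G.LocallyFinite] {ψ φ : V → Site 2}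

/-! ## §1 The shell of the forced kit: the union of the faces -/

section Shell

variable (G) {Lo Hi : Site 2} (SF : ∀ (i : Fin 2) (σ : ℤˣ), SideForm ψ φ Lo Hi i σ) (P : ApronPrm) (w₀ : V) (R : ℕ)
  (Λc : V → ℕ → Finset V) (kz : ℕ)

/-- **The shell of the re-centred forced kit** over the contact set `K`: the union of the faces (near: the zone datum about the column end; far: `{y}`) — the only
vertices the Step-V pinning has to see. [this work] -/
def pinSetFC (K : Finset V) : Finset V := K.biUnion fun x => (forcedGeomC G SF P w₀ R Λc kz).U x

variable {G SF P w₀ R Λc kz}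

omit [G.LocallyFinite] in
/-- Every face lies in the shell. [folklore] -/
theorem face_subset_pinSetFC {K : Finset V} {x : V} (hx : x ∈ K) : (forcedGeomC G SF P w₀ R Λc kz).U x ⊆ pinSetFC G SF P w₀ R Λc kz K :=
  Finset.subset_biUnion_of_mem (fun x => (forcedGeomC G SF P w₀ R Λc kz).U x) hx

omit [G.LocallyFinite] in
/-- The shell lies in any set containing every face. [folklore] -/
theorem pinSetFC_subset {K D : Finset V} (h : ∀ x ∈ K, (forcedGeomC G SF P w₀ R Λc kz).U x ⊆ D) : pinSetFC G SF P w₀ R Λc kz K ⊆ D :=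
  Finset.biUnion_subset.2 h

end Shell

/-! ## §2 The kit clause -/

/-- **THE KIT CLAUSE OF A WINDOW LEVEL WITH THE RE-CENTRED FORCED KIT** (the per-level clause of `TStep.KitsAtF`; J12 successor of `kitClauseF`: no `hcol`, zone datum about `ctColEnd x`): given the window
rows, the zone datum at the kit centres, per FAR contact its inner neighbour in the target, and per NEAR contact a zone-box vertex in the target or the
route datum at accuracy `δ³`, the seed data `kitSData … (forcedGeomC …)` with shell `pinSetFC …` satisfy the Step-III axioms, the counts, and the
RELAY CLAUSE at accuracy `δ`. [cite: KozmaNitzan2024, §4 Lemma 10, Steps III–IV (pp. 19–21)] [this work] -/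
theorem kitClauseFC [Countable V] {lo hi : Site 2} {j : ℕ} {w₀ : V} {R : ℕ}
    (SF : ∀ (i : Fin 2) (σ : ℤˣ), SideForm ψ φ (lo - (j : Site 2)) (hi + (j : Site 2)) i σ) (Rg : V → Finset V) {P : ApronPrm}
    {KCmax Rs rs cS cU Δ : ℕ}
    (hlip : Lip G ψ) (hq : QStepsN G ψ P.N) (hstep : Steps G φ) (hΔ : ∀ v, G.degree v ≤ Δ) {q : unitInterval} {δ : ℝ} (hδ : 0 < δ)
    -- the window level and the kit constants
    (hwide : ∀ i, (lo - (j : Site 2)) i + 2 * tanOff P.ℓs P.M ≤ (hi + (j : Site 2)) i)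
    (hdw : ∀ i, (lo - (j : Site 2)) i + (P.d + 2 : ℕ) ≤ (hi + (j : Site 2)) i)
    (hKC : ∀ (i : Fin 2) (σ : ℤˣ) (z : Site 2), (SF i σ).θ (1 + P.d) ≤ (SF i σ).lin z → (SF i σ).lin z < (SF i σ).θ (2 + P.d) →
      (SF i σ).kitK z (shellD P) P.A ≤ KCmax)
    (hA : 0 ≤ P.A) (hθA : ∀ (i : Fin 2) (σ : ℤˣ), (SF i σ).θ (2 + P.d) ≤ (SF i σ).θ (shellD P) + P.A)
    (hr₀ : P.N * (tanOff P.ℓs P.M + 2) + P.N * P.d + (KCmax + Rs) ≤ P.r₀) (hR : P.r₀ ≤ R)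
    (hT : (shellD P : ℤ) + KCmax + Rs ≤ tanOff P.ℓs P.M)
    (hDw : ∀ i, (lo - (j : Site 2)) i + ((shellD P + 1 + P.d + KCmax + Rs : ℕ) : ℤ) ≤ (hi + (j : Site 2)) i) (hDρ : Rs + 1 ≤ shellD P)
    (hRg : ∀ c, ∀ u ∈ Rg c, u ∈ graphBall G c Rs) (hRgcard : ∀ c, (Rg c).card ≤ cU) (hcU1 : 1 ≤ cU)
    (hrs : 1 + (P.N * (tanOff P.ℓs P.M + 2) + P.N * P.d + (KCmax + Rs)) ≤ rs)
    (hcS : (P.N + 1) * (tanOff P.ℓs P.M + 1) + (P.N + 1) * P.d + (KCmax + 1) + cU ≤ cS)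
    -- the zone datum at the kit centres
    {Λc : V → ℕ → Finset V} {kz : ℕ} (hΛRg : ∀ c, Λc c kz ⊆ Rg c) (hzconn : ∀ c, ∀ s ∈ Λc c kz, PathIn G (↑(Λc c kz) : Set V) c s)
    (hcz : ∀ c, c ∈ Λc c kz)
    -- the level's source/support, the weighting, the region (containing the level) and the target
    (k : ℕ) (o : V) (Sfin : Finset V) {Wt : Sym2 V → unitInterval} {D T : Finset V}
    (hXD : winLevel G ψ w₀ R lo hi j ⊆ D) {N : ℕ} (hN : k * (Δ + 1) ^ (2 * rs) ≤ N)
    (hk : (1 - (q : ℝ) ^ (1 + Δ * cS + cS * cU)) ^ k ≤ δ)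
    -- per contact: FAR — the inner neighbour in the target; NEAR — a zone-box vertex in the target, or the route datum at accuracy `δ³`
    (hfar : ∀ x ∈ outerBoundary (winGraph G w₀ R) (winLevel G ψ w₀ R lo hi j), ¬ IsNear G ψ (lo - (j : Site 2)) (hi + (j : Site 2)) P w₀ R x →
      ctY G ψ w₀ R (lo - (j : Site 2)) (hi + (j : Site 2)) x ∈ T)
    (hnear : ∀ x ∈ outerBoundary (winGraph G w₀ R) (winLevel G ψ w₀ R lo hi j), IsNear G ψ (lo - (j : Site 2)) (hi + (j : Site 2)) P w₀ R x →
      (∃ u ∈ Λc (ctColEnd G SF P w₀ R x) kz, u ∈ T) ∨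
      ∃ Qt Ft : Finset V, Ft ⊆ T ∧ Qt ⊆ D ∧
        1 - δ ^ 3 ≤ (prodBernoulli Wt).real (linkIn (↑Qt : Set V) (Λc (ctColEnd G SF P w₀ R x) kz) Ft)) :
    ∃ (σ : SData V) (S : Finset V), SHyp (winLData G ψ w₀ R lo hi o Sfin) j σ ∧ σ.N ≤ N ∧
      (1 - (q : ℝ) ^ σ.sB) ^ σ.k ≤ δ ∧ S ⊆ D ∧ (∀ x ∈ σ.K, σ.face x ⊆ S) ∧
      RelayClause (winLData G ψ w₀ R lo hi o Sfin) Wt j σ S T D δ := by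
  set K := outerBoundary (winGraph G w₀ R) (winLevel G ψ w₀ R lo hi j) with hKdef
  set κ := forcedGeomC G SF P w₀ R Λc kz with hκ
  set S' := pinSetFC G SF P w₀ R Λc kz K with hS'
  have hOK : KitOK G ψ w₀ R lo hi j rs cS cU κ :=
    kitOK_forcedC SF Rg hlip hq hstep hwide hdw hKC hA hθA hr₀ hR hT hDw hDρ hRg hRgcard hcU1 hrs hcS hΛRg hzconn hcz
  have hSX : S' ⊆ winLevel G ψ w₀ R lo hi j := pinSetFC_subset fun x hx => hOK.U_sub x hx
  have hSD : S' ⊆ D := hSX.trans hXD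
  have hUS : ∀ x ∈ K, κ.U x ⊆ S' := fun x hx => face_subset_pinSetFC hx
  have hσ : SHyp (winLData G ψ w₀ R lo hi o Sfin) j (kitSData G ψ hΔ w₀ R lo hi j κ rs cS cU k) := shyp_kit hOK hlip o Sfin k
  refine ⟨kitSData G ψ hΔ w₀ R lo hi j κ rs cS cU k, S', hσ, hN, hk, hSD, fun x hx => ?_, ?_⟩
  · rw [kitSData_K] at hx; rw [kitSData_face]; exact hUS x hx
  refine relayClause_of_forced hσ (by rw [winLData_X]; exact hSX) hSD (fun x hx => by rw [kitSData_K] at hx; rw [kitSData_face]; exact hUS x hx)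
    hδ fun x hx => ?_
  rw [kitSData_K] at hx
  rw [kitSData_face, kitSData_seed]
  by_cases hnx : IsNear G ψ (lo - (j : Site 2)) (hi + (j : Site 2)) P w₀ R x
  · have hUx : κ.U x = Λc (ctColEnd G SF P w₀ R x) kz := forcedGeomC_U_of_near hnx
    rcases hnear x hx hnx with ⟨u, hu, huT⟩ | ⟨Qt, Ft, hFtT, hQtD, h3⟩
    · exact Or.inl ⟨u, by rw [hUx]; exact hu, huT⟩
    refine Or.inr ⟨⟨ctColEnd G SF P w₀ R x, by rw [hUx]; exact hcz _⟩, fun ω hω u hu v hv => ?_, Qt, Ft, hFtT, hQtD, by rw [hUx]; exact h3⟩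
    -- `hbox`: the `G`-edges inside the face are seed edges inside the shell, hence open; the face is connected through its centre
    rw [hUx] at hu hv
    set c := ctColEnd G SF P w₀ R x with hc
    have hZW : Λc c kz ⊆ winLevel G ψ w₀ R lo hi j := by have h := hOK.U_sub x hx; rw [hUx] at h; exact h
    have hZD : (↑(Λc c kz) : Set V) ⊆ ↑D := Finset.coe_subset.2 (hZW.trans hXD)
    have hopen : ∀ a b, a ∈ (↑(Λc c kz) : Set V) → b ∈ (↑(Λc c kz) : Set V) → G.Adj a b → s(a, b) ∈ ω := by
      intro a b ha hb hab
      have haS : a ∈ κ.S x := forcedGeomC_U_subset_S x (by rw [hUx]; exact Finset.mem_coe.1 ha)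
      have hbS : b ∈ κ.S x := forcedGeomC_U_subset_S x (by rw [hUx]; exact Finset.mem_coe.1 hb)
      refine hω _ (edgesIn_subset_kitSeed κ x ((mem_edgesIn_iff).2 ⟨(SimpleGraph.mem_edgeSet (G := G)).2 hab, fun z hz => ?_⟩)) ?_
      · rcases Sym2.mem_iff.1 hz with rfl | rfl
        · exact haS
        · exact hbS
      · refine mk_mem_wireSet_iff.2 ⟨?_, ?_, hab.ne⟩
        · exact Finset.mem_coe.2 (hUS x hx (by rw [hUx]; exact Finset.mem_coe.1 ha))
        · exact Finset.mem_coe.2 (hUS x hx (by rw [hUx]; exact Finset.mem_coe.1 hb))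
    have hpu : PathIn (openGraph ω) (↑D : Set V) c u := pathIn_openGraph_of_open hZD hopen (hzconn c u hu)
    have hpv : PathIn (openGraph ω) (↑D : Set V) c v := pathIn_openGraph_of_open hZD hopen (hzconn c v hv)
    exact DCT16.mem_openConnIn_iff_pathIn.2 (hpu.symm.trans hpv)
  · have hUx : κ.U x = {ctY G ψ w₀ R (lo - (j : Site 2)) (hi + (j : Site 2)) x} := forcedGeomC_U_of_far hnx
    exact Or.inl ⟨_, by rw [hUx]; exact Finset.mem_singleton_self _, hfar x hx hnx⟩

end Skelφ

end Summit.CriticalPhenomena.PercolationContinuityZ3.Theorems.Transplant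

end
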